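import Literature.AlgebraicGeometry.Milne1999.SpecialLefschetzGroupInvariantsSpBlocksMultiplicity
import Literature.AlgebraicGeometry.Milne1999.SpecialLefschetzGroupInvariantsSymplecticPowers
import Literature.RepresentationTheory.ClassicalInvariants.OrthogonalTensorFFTColoured
import HarnessLib

/-!
# Milne 1999, Prop. 3.6 (a) AND (b) with multiplicity, several blocks of both kinds: the invariants of
# `⋀•(⊕_σ V_σ ⊗ ℂ^{m_σ})` under `∏_σ G_σ`, `G_σ ∈ {Sp(V_σ), O(V_σ)}`, are Lefschetz classes; and the
# crossed classes of a divisor class pairing TWO families of letters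

Family `hodge`, layer `Literature/AlgebraicGeometry/Milne1999`, namespace
`Literature.AlgebraicGeometry.Milne1999` (D-0022). THEOREMS ONLY (no `def`, no named fact, no `sorry`;
D-0026, net debt 0). Written for the cell `pub-hodgecm2` (COR-CM), seat `lit-milne`, binder table
`HOME/lit/milne.md` row M4 (the record `Milne1999_specialLefschetzGroup_invariants_le`; its wording is
untouched and it is NOT discharged here). Sequel of `Milne1999/SpecialLefschetzGroupInvariantsSpBlocksMultiplicity`
(all blocks symplectic), through the coloured tensor FFT for products of orthogonal and symplectic groups
(`RepresentationTheory/ClassicalInvariants/OrthogonalTensorFFTColoured`). Consumer: the powers of an abelian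
variety of type III (`S(A)_{k^al} ≅ ∏_σ O(φ_{2,σ₁})`, Milne §2 p. 650), sequel file.

## Source, verbatim

J. S. Milne, *Lefschetz classes on abelian varieties*, Duke Math. J. 96 (1999) 639–675
[`paper:doi-10-1215-s0012-7094-99-09620-5`, held; PDF page = printed page − 638]:

* §2 p. 649: "`S(A)_{/k^{al}} = ∏_σ S_σ`"; p. 650 (type III): "`S(A)_{k^al} ≅ ∏ O(φ_{2,σ₁})` where the
  product is indexed by the embeddings `σ: F → k^al` […] The representation of `O(φ_{2,σ₁})` on `V_{σ₁}` […]
  is its standard representation, and its representation on `V_{σ₂}` is the contragredient of the standard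
  representation (which is isomorphic to the standard representation)."
* pp. 654–655 (p0016–p0017): "The symplectic group. […] The orthogonal group. Let `φ` be a nondegenerate
  symmetric bilinear form on `V`, and let `G = O(φ)` […] for even `m`, `(H^{⊗m})^G` is generated as a
  `k[S_m]`-algebra by `φ ⊗ ⋯ ⊗ φ` (`m/2` copies)"; Prop. 3.6: "`(⋀^*(rH))^G = k[(⊗² rH)^G]` all `r ≥ 1`,
  in each of the following cases: (a) `G = Sp(φ)` […]; (b) `G = O(φ)` […]"; p. 656: "`(⋀^*(⊕ rH_σ))^{∏S_σ} =
  ⊗_σ (⋀^* rH_σ)^{S_σ}`. Hence it suffices to show that each of the `k`-algebras `(⋀^* rH_σ)^{S_σ}` is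
  generated by tensors of degree 2"; Prop. 3.3 and §3 p. 654 ("`φ` can be identified with an element of
  `H ⊗ H`"); Cor. 4.5 (p. 659).

## What is proved

* §1 **`mem_divisorClassesSpan_of_forall_exteriorPullback_eq_of_formBlocks`** — Prop. 3.6 (a), (b) with
  multiplicity for several blocks of both kinds, `S(ℂ)`-form on the carriers: `b` a basis of `H¹(B(ℂ); ℂ)`
  indexed by slots `s ∈ J` (colour `col s`) and letters `Fin N`, one nondegenerate matrix `Ω_i` per colour,
  each ALTERNATING OR SYMMETRIC, `G ≤ GL(H¹)` containing for every colour `i` and every `g` with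
  `gᵀ Ω_i g = Ω_i` the element acting by `g` on the slots of colour `i` and trivially elsewhere, crossed
  classes `∑ (Ω_{col s}⁻¹)_{ab} b(s,a) ⌣ b(s',b)` of equal-coloured slots in `B¹ ⊗ ℂ` ⟹ every `G`-fixed
  class of `H^{2p}` is in `divisorClassesSpan B.X B.dim p`; `…_of_orthBlocks` (all blocks orthogonal).
* §2 the crossed classes of a divisor class `θ = ∑ X_{aa'} e_a ⌣ e'_{a'}` pairing TWO families of letters:
  `sum_sum_smul_bilin_eq₂` (change of variables), `sum_smul_cross₂_add_mem_span_rational_oneOne`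
  (`(f+g)^*θ − f^*θ − g^*θ =` the sum of the two mixed terms), and the separation lemma
  **`sum_smul_cross₂_mem_span_rational_oneOne`**: if an endomorphism `ψ` of `A` acts on the two families
  by different scalars, then EACH mixed term `∑ X_{aa'} f^*e_a ⌣ g^*e'_{a'}` is in `B¹ ⊗ ℂ` (replace `g` by
  `g ≫ ψ` and eliminate) — the device for type III, where `Q_h` pairs `V_{σ₁}` with `V_{σ₂}`.

NOT here: the application to an endomorphism structure (sequel); general linear blocks mixed in; the record.

## References

* [Milne1999LefschetzClasses] J. S. Milne, Lefschetz classes on abelian varieties, Duke Math. J. 96 (1999)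
  639–675: §2 pp. 649–650, pp. 654–655 "The symplectic group", "The orthogonal group", Prop. 3.3,
  Prop. 3.6 (a), (b), Remark 3.7, p. 656, Cor. 4.5 (p. 659).
* [GoodmanWallachGTM255] R. Goodman, N. R. Wallach, GTM 255 (2009), Thm. 5.3.3 (1), (2), Thm. 5.3.5, §4.1.1.
* [HatcherAT2002] A. Hatcher, Algebraic Topology (2002), §3.2 Prop. 3.10 (naturality of cup product).
-/

noncomputable section

open scoped BigOperators Matrix
open CategoryTheory
open Literature.AlgebraicTopology.SingularHomology
open Literature.AlgebraicGeometry.HodgeTheory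
open Literature.AlgebraicGeometry.Motives
open Literature.Barriers.HodgeConjecture (divisorClassesSpan)
open Literature.RepresentationTheory.GeneralLinear
open Literature.RepresentationTheory.ClassicalInvariants
open Literature.NumberTheory.DiophantineGeometry

namespace Literature.AlgebraicGeometry.Milne1999

/-! ### §1 Prop. 3.6 (a), (b) with multiplicity for several blocks of both kinds -/

section Main

variable {B : AbelianVariety ℂ} {J ι : Type*} [Fintype J] [DecidableEq J] [DecidableEq ι] {N : ℕ}

/-- **Milne 1999, Prop. 3.6 (a) and (b) with multiplicity, `S(ℂ)`-form on the carriers, SEVERAL blocks of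
both kinds.** Let `B` be a complex abelian variety, `b` a basis of `H¹(B(ℂ); ℂ)` indexed by slots `s ∈ J` and
letters `ℓ ∈ Fin N`, every slot carrying a colour `col s ∈ ι` and every colour a nondegenerate matrix `Ω_i`
which is alternating or symmetric (the form `φ_σ` on `V_σ = ℂ^N`: `Sp` for types I and II, `O` for type
III, Milne §2), and `G ≤ GL(H¹)` a subgroup containing, for every colour `i` and every `g` with
`gᵀ Ω_i g = Ω_i`, the element acting by `g` on the slots of colour `i` and trivially on the others — the group
`∏_σ G_σ`, `G_σ ∈ {Sp(V_σ), O(V_σ)}`, acting on `⊕_σ V_σ ⊗ ℂ^{m_σ}`. Suppose the CROSSED CLASSES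
`θ_{s,s'} = ∑_{a,b} (Ω_{col s}⁻¹)_{ab} b(s,a) ⌣ b(s',b)` of any two slots of the same colour lie in `B¹(B) ⊗ ℂ`.
Then every class `x ∈ H^{2p}(B(ℂ); ℂ)` fixed by `⋀^{2p}u` for all `u ∈ G` lies in
`Dᵖ(B) ⊗ ℂ = divisorClassesSpan B.X B.dim p` ("`(⋀^*(rH))^G = k[(⊗² rH)^G]` […] (a) `G = Sp(φ)` […] (b)
`G = O(φ)`", with p. 656). Proof: that of `…_of_spBlocks` with the mixed coloured tensor FFT
`ClassicalInvariants.mem_span_colouredContraction_of_forall_wordRepAt_eq_of_isAlt_or_isSymm` (every complex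
number is a square).
[cite: Milne1999LefschetzClasses, §2 pp. 649–650, Prop. 3.6 (a), (b) (pp. 654–655), Remark 3.7 and p. 656, Cor. 4.5 (p. 659)]
[cite: GoodmanWallachGTM255, Thm. 5.3.3 (1), (2) and Thm. 5.3.5] -/
theorem mem_divisorClassesSpan_of_forall_exteriorPullback_eq_of_formBlocks
    (b : Module.Basis (J × Fin N) ℂ (complexBetti B.X 1)) (col : J → ι) (Ω : ι → Matrix (Fin N) (Fin N) ℂ)
    (hΩ : ∀ i, (Matrix.toBilin' (Ω i)).IsAlt ∨ (Matrix.toBilin' (Ω i)).IsSymm)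
    (hΩn : ∀ i, (Matrix.toBilin' (Ω i)).Nondegenerate)
    (G : Subgroup (complexBetti B.X 1 ≃ₗ[ℂ] complexBetti B.X 1))
    (hG : ∀ (i : ι) (g : Matrix (Fin N) (Fin N) ℂ), gᵀ * Ω i * g = Ω i → ∃ u ∈ G, ∀ s ℓ,
      u (b (s, ℓ)) = ∑ ℓ', (if col s = i then g else 1) ℓ' ℓ • b (s, ℓ'))
    (hcross : ∀ s s' : J, col s = col s' →
      (∑ a : Fin N, ∑ a' : Fin N, (Ω (col s))⁻¹ a a' • cupProduct (rfl : 1 + 1 = 2) (b (s, a)) (b (s', a'))) ∈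
        Submodule.span ℂ {c : complexBetti B.X 2 | IsRationalClass c ∧ IsOfHodgeType B.dim B.X 2 1 1 c})
    (p : ℕ) (x : complexBetti B.X (2 * p))
    (hx : ∀ u ∈ G, exteriorPullback (AbelianVariety.hasExteriorCohomologyH1_complexPoints B)
      (u : complexBetti B.X 1 →ₗ[ℂ] complexBetti B.X 1) (2 * p) x = x) :
    x ∈ divisorClassesSpan B.X B.dim p := by
  classical
  have hsq : ∀ a : ℂ, IsSquare a := fun a => IsAlgClosed.exists_eq_mul_self a
  set F := cupPowOneAlt ℂ (ComplexPoints B.X) (2 * p) with hF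
  obtain ⟨a, ha, hax⟩ := exists_isAntisymm_wordEval_eq b x
  -- every slice is a `∏ G_σ`-invariant tensor
  have hinv : ∀ (t : Fin (2 * p) → J) (i : ι) (g : Matrix (Fin N) (Fin N) ℂ), gᵀ * Ω i * g = Ω i →
      wordRepAt ℂ (fun q => if (col ∘ t) q = i then g else 1) (wordSlice a t) = wordSlice a t := by
    intro t i g hg
    obtain ⟨u, huG, hu⟩ := hG i g hg
    exact wordRepAt_wordSlice_eq_of_exteriorPullback_eq' b ha (u : complexBetti B.X 1 →ₗ[ℂ] complexBetti B.X 1)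
      (fun s => if col s = i then g else 1) (fun s ℓ => hu s ℓ) (by rw [hax]; exact hx u huG) t
  -- slice by slice: the mixed coloured tensor FFT and the evaluation of the complete contractions
  rw [← hax, wordEval_eq_sum_wordSlice]
  refine Submodule.sum_mem _ fun t _ => ?_
  have hmem := mem_span_colouredContraction_of_forall_wordRepAt_eq_of_isAlt_or_isSymm hsq Ω hΩ hΩn (col ∘ t)
    (wordSlice a t) (hinv t)
  set Λ := Fintype.linearCombination ℂ (fun ε : Word N (2 * p) => F (fun q => b (t q, ε q))) with hΛ
  have hΛapply : ∀ c : Word N (2 * p) → ℂ, Λ c = ∑ ε, c ε • F (fun q => b (t q, ε q)) :=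
    fun c => Fintype.linearCombination_apply ℂ _ c
  rw [← hΛapply]
  refine (Submodule.span_le (p := (divisorClassesSpan B.X B.dim p).comap Λ)).2 ?_ hmem
  rintro _ ⟨k, e, he, rfl⟩
  rw [SetLike.mem_coe, Submodule.mem_comap, hΛapply]
  -- `k = p`: the two-partition has `p` pairs
  have hk : k = p := by
    have h := Fintype.card_congr e
    simp only [Fintype.card_fin, Fintype.card_prod] at h
    omega
  subst hk
  obtain ⟨π, -, hsum⟩ := sum_colouredContraction_smul_eq F (fun i => (Ω i)⁻¹) (col ∘ t) e (⇑b) t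
  rw [hsum]
  refine Submodule.smul_mem _ _ ?_
  simp_rw [hF, cupPowOneAlt_apply]
  refine sum_smul_cupPowOne_spPairWord_mem_family (⇑b) k _ _ _ fun c => ?_
  exact hcross _ _ (he c)

/-- **Milne 1999, Prop. 3.6 (b) with multiplicity, SEVERAL orthogonal blocks** (`∏_σ O(V_σ)` — type III,
§2 p. 650: "`S(A)_{k^al} ≅ ∏ O(φ_{2,σ₁})`"): the case of `…_of_formBlocks` with every `Ω_i` symmetric.
[cite: Milne1999LefschetzClasses, §2 p. 650, Prop. 3.6 (b) (p. 655), p. 656, Cor. 4.5 (p. 659)]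
[cite: GoodmanWallachGTM255, Thm. 5.3.3 (1) and Thm. 5.3.5] -/
theorem mem_divisorClassesSpan_of_forall_exteriorPullback_eq_of_orthBlocks
    (b : Module.Basis (J × Fin N) ℂ (complexBetti B.X 1)) (col : J → ι) (Ω : ι → Matrix (Fin N) (Fin N) ℂ)
    (hΩs : ∀ i, (Matrix.toBilin' (Ω i)).IsSymm) (hΩn : ∀ i, (Matrix.toBilin' (Ω i)).Nondegenerate)
    (G : Subgroup (complexBetti B.X 1 ≃ₗ[ℂ] complexBetti B.X 1))
    (hG : ∀ (i : ι) (g : Matrix (Fin N) (Fin N) ℂ), gᵀ * Ω i * g = Ω i → ∃ u ∈ G, ∀ s ℓ,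
      u (b (s, ℓ)) = ∑ ℓ', (if col s = i then g else 1) ℓ' ℓ • b (s, ℓ'))
    (hcross : ∀ s s' : J, col s = col s' →
      (∑ a : Fin N, ∑ a' : Fin N, (Ω (col s))⁻¹ a a' • cupProduct (rfl : 1 + 1 = 2) (b (s, a)) (b (s', a'))) ∈
        Submodule.span ℂ {c : complexBetti B.X 2 | IsRationalClass c ∧ IsOfHodgeType B.dim B.X 2 1 1 c})
    (p : ℕ) (x : complexBetti B.X (2 * p))
    (hx : ∀ u ∈ G, exteriorPullback (AbelianVariety.hasExteriorCohomologyH1_complexPoints B)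
      (u : complexBetti B.X 1 →ₗ[ℂ] complexBetti B.X 1) (2 * p) x = x) :
    x ∈ divisorClassesSpan B.X B.dim p :=
  mem_divisorClassesSpan_of_forall_exteriorPullback_eq_of_formBlocks b col Ω (fun i => Or.inr (hΩs i)) hΩn G
    hG hcross p x hx

end Main

/-! ### §2 Crossed classes of a divisor class pairing two families of letters -/

section CrossTwo

variable {V W : Type*} [AddCommGroup V] [Module ℂ V] [AddCommGroup W] [Module ℂ W] {n : ℕ}

/-- Bilinear expansion `Φ(∑ αₐ xₐ, ∑ β_c y_c) = ∑∑ αₐ β_c Φ(xₐ, y_c)` for a bilinear map. [folklore] -/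
private theorem bilin_sum_smul_sum_smul₂ (Φ : V →ₗ[ℂ] V →ₗ[ℂ] W) (α β : Fin n → ℂ) (x y : Fin n → V) :
    Φ (∑ a, α a • x a) (∑ c, β c • y c) = ∑ a, ∑ c, (α a * β c) • Φ (x a) (y c) := by
  rw [map_sum Φ (fun a => α a • x a) Finset.univ, LinearMap.sum_apply]
  refine Finset.sum_congr rfl fun a _ => ?_
  rw [map_smul, LinearMap.smul_apply, map_sum, Finset.smul_sum]
  refine Finset.sum_congr rfl fun c _ => ?_
  rw [map_smul, smul_smul]

/-- **Change of variables in a `2`-tensor on TWO families**: if `u e_a = ∑_{a'} M_{a'a} e_{a'}` and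
`u e'_c = ∑_{c'} M'_{c'c} e'_{c'}` then `∑_{a,c} X_{ac} Φ(u e_a, u e'_c) = ∑_{a',c'} (M X M'ᵀ)_{a'c'} Φ(e_{a'}, e'_{c'})`
(Goodman–Wallach (5.34) for `V ⊗ V'`). [cite: GoodmanWallachGTM255, Thm. 5.3.3 (proof, (5.34))] -/
theorem sum_sum_smul_bilin_eq₂ (Φ : V →ₗ[ℂ] V →ₗ[ℂ] W) (e e' : Fin n → V) {u : V → V}
    {M M' : Matrix (Fin n) (Fin n) ℂ} (hu : ∀ i, u (e i) = ∑ a, M a i • e a)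
    (hu' : ∀ i, u (e' i) = ∑ a, M' a i • e' a) (X : Matrix (Fin n) (Fin n) ℂ) :
    ∑ a, ∑ c, X a c • Φ (u (e a)) (u (e' c)) = ∑ a', ∑ c', (M * X * M'ᵀ) a' c' • Φ (e a') (e' c') := by
  have hL : ∑ a, ∑ c, X a c • Φ (u (e a)) (u (e' c)) =
      ∑ a, ∑ c, ∑ a', ∑ c', (X a c * (M a' a * M' c' c)) • Φ (e a') (e' c') := by
    refine Finset.sum_congr rfl fun a _ => Finset.sum_congr rfl fun c _ => ?_
    rw [hu, hu', bilin_sum_smul_sum_smul₂, Finset.smul_sum]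
    refine Finset.sum_congr rfl fun a' _ => ?_
    rw [Finset.smul_sum]
    refine Finset.sum_congr rfl fun c' _ => ?_
    rw [smul_smul]
  have hR : ∑ a', ∑ c', (M * X * M'ᵀ) a' c' • Φ (e a') (e' c') =
      ∑ a', ∑ c', ∑ a, ∑ c, (X a c * (M a' a * M' c' c)) • Φ (e a') (e' c') := by
    refine Finset.sum_congr rfl fun a' _ => Finset.sum_congr rfl fun c' _ => ?_
    rw [Matrix.mul_apply, Finset.sum_smul]
    simp_rw [Matrix.mul_apply, Finset.sum_mul, Finset.sum_smul, Matrix.transpose_apply]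
    rw [Finset.sum_comm]
    refine Finset.sum_congr rfl fun a _ => Finset.sum_congr rfl fun c _ => ?_
    congr 1
    ring
  rw [hL, hR]
  -- reorder the four sums `(a, c, a', c') → (a', c', a, c)`
  calc ∑ a, ∑ c, ∑ a', ∑ c', (X a c * (M a' a * M' c' c)) • Φ (e a') (e' c')
      = ∑ a, ∑ a', ∑ c, ∑ c', (X a c * (M a' a * M' c' c)) • Φ (e a') (e' c') :=
        Finset.sum_congr rfl fun a _ => Finset.sum_comm
    _ = ∑ a', ∑ a, ∑ c, ∑ c', (X a c * (M a' a * M' c' c)) • Φ (e a') (e' c') := Finset.sum_comm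
    _ = ∑ a', ∑ a, ∑ c', ∑ c, (X a c * (M a' a * M' c' c)) • Φ (e a') (e' c') :=
        Finset.sum_congr rfl fun a' _ => Finset.sum_congr rfl fun a _ => Finset.sum_comm
    _ = ∑ a', ∑ c', ∑ a, ∑ c, (X a c * (M a' a * M' c' c)) • Φ (e a') (e' c') :=
        Finset.sum_congr rfl fun a' _ => Finset.sum_comm

/-- **The Gram matrix of a form on two transformed families**: `B(u e_i, u e'_j) = (Mᵀ Θ M')_{ij}` with
`Θ_{ac} = B(e_a, e'_c)`. [cite: Milne1999LefschetzClasses, §1 p. 644] -/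
theorem bilin_apply_family₂_eq_transpose_mul_mul (B' : LinearMap.BilinForm ℂ V) (e e' : Fin n → V)
    {u : V → V} {M M' : Matrix (Fin n) (Fin n) ℂ} (hu : ∀ i, u (e i) = ∑ a, M a i • e a)
    (hu' : ∀ i, u (e' i) = ∑ a, M' a i • e' a) (i j : Fin n) :
    B' (u (e i)) (u (e' j)) = (Mᵀ * (Matrix.of fun a c => B' (e a) (e' c)) * M') i j := by
  rw [hu, hu', bilin_sum_smul_sum_smul₂, Matrix.mul_apply]
  simp_rw [Matrix.mul_apply, Matrix.transpose_apply, Matrix.of_apply, Finset.sum_mul, smul_eq_mul]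
  rw [Finset.sum_comm]
  refine Finset.sum_congr rfl fun c _ => Finset.sum_congr rfl fun a _ => ?_
  ring

variable {A : AbelianVariety ℂ}

/-- **The polarization identity for a divisor class pairing two families**: for `θ = ∑ X_{ac} e_a ⌣ e'_c ∈
B¹(A) ⊗ ℂ` and homomorphisms `f, g : T → A`, `(f + g)^*θ − f^*θ − g^*θ = ∑ X_{ac} f^*e_a ⌣ g^*e'_c +
∑ X_{ac} g^*e_a ⌣ f^*e'_c` lies in `B¹(T) ⊗ ℂ` (pull-back is additive on `H¹` and multiplicative). Milne's
degree-`2` invariants of `A^r` placed on two slots (Prop. 3.3 for `A × A`, "`φ ∈ H ⊗ H`", p. 654).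
[cite: Milne1999LefschetzClasses, Prop. 3.3 and §3 p. 654] [cite: HatcherAT2002, §3.2 Prop. 3.10] -/
theorem sum_smul_cross₂_add_mem_span_rational_oneOne {T : AbelianVariety ℂ} (f g : T ⟶ A)
    (e e' : Fin n → complexBetti A.X 1) (X : Matrix (Fin n) (Fin n) ℂ)
    (hθ : (∑ a, ∑ c, X a c • cupProduct (rfl : 1 + 1 = 2) (e a) (e' c)) ∈
      Submodule.span ℂ {c : complexBetti A.X 2 | IsRationalClass c ∧ IsOfHodgeType A.dim A.X 2 1 1 c}) :
    (∑ a, ∑ c, X a c • cupProduct (rfl : 1 + 1 = 2) (complexBetti.map f.hom.hom.hom 1 (e a))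
        (complexBetti.map g.hom.hom.hom 1 (e' c))) +
      (∑ a, ∑ c, X a c • cupProduct (rfl : 1 + 1 = 2) (complexBetti.map g.hom.hom.hom 1 (e a))
        (complexBetti.map f.hom.hom.hom 1 (e' c))) ∈
      Submodule.span ℂ {c : complexBetti T.X 2 | IsRationalClass c ∧ IsOfHodgeType T.dim T.X 2 1 1 c} := by
  have hT : IsSmoothProjective T.dim T.X := AbelianVariety.isSmoothProjective_holds
  have hAs : IsSmoothProjective A.dim A.X := AbelianVariety.isSmoothProjective_holds
  set θ : complexBetti A.X 2 := ∑ a, ∑ c, X a c • cupProduct (rfl : 1 + 1 = 2) (e a) (e' c) with hθdef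
  have hpull : ∀ ψ : T ⟶ A, complexBetti.map ψ.hom.hom.hom 2 θ =
      ∑ a, ∑ c, X a c • cupProduct (rfl : 1 + 1 = 2) (complexBetti.map ψ.hom.hom.hom 1 (e a))
        (complexBetti.map ψ.hom.hom.hom 1 (e' c)) := by
    intro ψ
    rw [hθdef, map_sum]
    refine Finset.sum_congr rfl fun a _ => ?_
    rw [map_sum]
    refine Finset.sum_congr rfl fun c _ => ?_
    rw [map_smul, complexBetti.map_cupProduct]
  have key : (∑ a, ∑ c, X a c • cupProduct (rfl : 1 + 1 = 2) (complexBetti.map f.hom.hom.hom 1 (e a))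
        (complexBetti.map g.hom.hom.hom 1 (e' c))) +
      (∑ a, ∑ c, X a c • cupProduct (rfl : 1 + 1 = 2) (complexBetti.map g.hom.hom.hom 1 (e a))
        (complexBetti.map f.hom.hom.hom 1 (e' c))) =
      complexBetti.map (f + g).hom.hom.hom 2 θ - complexBetti.map f.hom.hom.hom 2 θ -
        complexBetti.map g.hom.hom.hom 2 θ := by
    have hadd : ∀ v : complexBetti A.X 1, complexBetti.map (f + g).hom.hom.hom 1 v =
        complexBetti.map f.hom.hom.hom 1 v + complexBetti.map g.hom.hom.hom 1 v :=
      fun v => complexBetti_map_add_deg_one f g v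
    rw [hpull, hpull, hpull]
    simp only [hadd, map_add, LinearMap.add_apply, smul_add, Finset.sum_add_distrib]
    abel
  rw [key]
  exact Submodule.sub_mem _ (Submodule.sub_mem _ (map_mem_span_rational_oneOne hT hAs _ hθ)
    (map_mem_span_rational_oneOne hT hAs _ hθ)) (map_mem_span_rational_oneOne hT hAs _ hθ)

/-- **Separation of the two mixed terms by an endomorphism** (the device for type III, where the
polarization pairs `V_{σ₁}` with `V_{σ₂} = β V_{σ₁}` and `θ_σ ∈ B¹(A) ⊗ ℂ` pairs the letters of `V_{σ₁}` with
those of `V_{σ₂}`, Milne §2 p. 650): if `θ = ∑ X_{ac} e_a ⌣ e'_c ∈ B¹(A) ⊗ ℂ` and an endomorphism `ψ` of `A`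
acts by `ψ^* e_a = μ e_a`, `ψ^* e'_c = μ' e'_c` with `μ ≠ μ'`, then for all homomorphisms `f, g : T → A` the
crossed class `∑ X_{ac} f^*e_a ⌣ g^*e'_c` lies in `B¹(T) ⊗ ℂ`: the polarization identity for `(f, g)` and for
`(f, g ∘ ψ)` gives `C + C' ∈ B¹` and `μ' C + μ C' ∈ B¹`, whence `(μ' − μ) C ∈ B¹`.
[cite: Milne1999LefschetzClasses, §2 p. 650, Prop. 3.3 and §3 p. 654] [cite: HatcherAT2002, §3.2 Prop. 3.10] -/
theorem sum_smul_cross₂_mem_span_rational_oneOne {T : AbelianVariety ℂ} (f g : T ⟶ A) (ψ : A ⟶ A)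
    (e e' : Fin n → complexBetti A.X 1) {μ μ' : ℂ} (hμ : μ ≠ μ')
    (he : ∀ a, complexBetti.map ψ.hom.hom.hom 1 (e a) = μ • e a)
    (he' : ∀ c, complexBetti.map ψ.hom.hom.hom 1 (e' c) = μ' • e' c) (X : Matrix (Fin n) (Fin n) ℂ)
    (hθ : (∑ a, ∑ c, X a c • cupProduct (rfl : 1 + 1 = 2) (e a) (e' c)) ∈
      Submodule.span ℂ {c : complexBetti A.X 2 | IsRationalClass c ∧ IsOfHodgeType A.dim A.X 2 1 1 c}) :
    (∑ a, ∑ c, X a c • cupProduct (rfl : 1 + 1 = 2) (complexBetti.map f.hom.hom.hom 1 (e a))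
        (complexBetti.map g.hom.hom.hom 1 (e' c))) ∈
      Submodule.span ℂ {c : complexBetti T.X 2 | IsRationalClass c ∧ IsOfHodgeType T.dim T.X 2 1 1 c} := by
  set C : complexBetti T.X 2 := ∑ a, ∑ c, X a c • cupProduct (rfl : 1 + 1 = 2)
    (complexBetti.map f.hom.hom.hom 1 (e a)) (complexBetti.map g.hom.hom.hom 1 (e' c)) with hCdef
  set C' : complexBetti T.X 2 := ∑ a, ∑ c, X a c • cupProduct (rfl : 1 + 1 = 2)
    (complexBetti.map g.hom.hom.hom 1 (e a)) (complexBetti.map f.hom.hom.hom 1 (e' c)) with hC'def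
  have h1 : C + C' ∈ Submodule.span ℂ {c : complexBetti T.X 2 | IsRationalClass c ∧
      IsOfHodgeType T.dim T.X 2 1 1 c} := sum_smul_cross₂_add_mem_span_rational_oneOne f g e e' X hθ
  have h2 := sum_smul_cross₂_add_mem_span_rational_oneOne f (g ≫ ψ) e e' X hθ
  have hgψ : ∀ v : complexBetti A.X 1, complexBetti.map (g ≫ ψ).hom.hom.hom 1 v =
      complexBetti.map g.hom.hom.hom 1 (complexBetti.map ψ.hom.hom.hom 1 v) :=
    fun v => complexBetti_map_comp_apply g ψ v
  have hC2 : (∑ a, ∑ c, X a c • cupProduct (rfl : 1 + 1 = 2) (complexBetti.map f.hom.hom.hom 1 (e a))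
      (complexBetti.map (g ≫ ψ).hom.hom.hom 1 (e' c))) = μ' • C := by
    rw [hCdef, Finset.smul_sum]
    refine Finset.sum_congr rfl fun a _ => ?_
    rw [Finset.smul_sum]
    refine Finset.sum_congr rfl fun c _ => ?_
    rw [hgψ, he', map_smul, map_smul, smul_comm]
  have hC'2 : (∑ a, ∑ c, X a c • cupProduct (rfl : 1 + 1 = 2) (complexBetti.map (g ≫ ψ).hom.hom.hom 1 (e a))
      (complexBetti.map f.hom.hom.hom 1 (e' c))) = μ • C' := by
    rw [hC'def, Finset.smul_sum]
    refine Finset.sum_congr rfl fun a _ => ?_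
    rw [Finset.smul_sum]
    refine Finset.sum_congr rfl fun c _ => ?_
    rw [hgψ, he, map_smul, map_smul, LinearMap.smul_apply, smul_comm]
  rw [hC2, hC'2] at h2
  -- `(μ' − μ) C = (μ' C + μ C') − μ (C + C')`
  have h3 : (μ' - μ) • C = (μ' • C + μ • C') - μ • (C + C') := by
    rw [sub_smul, smul_add]
    abel
  have hmem : (μ' - μ) • C ∈ Submodule.span ℂ {c : complexBetti T.X 2 | IsRationalClass c ∧
      IsOfHodgeType T.dim T.X 2 1 1 c} := by
    rw [h3]
    exact Submodule.sub_mem _ h2 (Submodule.smul_mem _ _ h1)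
  have hne : μ' - μ ≠ 0 := sub_ne_zero.2 (Ne.symm hμ)
  have h4 : C = (μ' - μ)⁻¹ • ((μ' - μ) • C) := by
    rw [smul_smul, inv_mul_cancel₀ hne, one_smul]
  rw [h4]
  exact Submodule.smul_mem _ _ hmem

end CrossTwo

end Literature.AlgebraicGeometry.Milne1999
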